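import Summits.BirchSwinnertonDyer.Rank1Residual.X11b.KummerTorsionDecomposition
import Summits.BirchSwinnertonDyer.Rank1Residual.X11b.BDPRouteSelmerCardBound
import HarnessLib

/-!
# Class X11b, routes p2/R1: bookkeeping lemmas for the EXACT base Selmer count
# (cell `b2b-bsdres`, sub-cell `multr1-p2`, gen 19)

HONEST FRAMING (verbatim, cell `b2b-bsdres`): "We develop the residual theory around the BSD formula
for a specific rank-1 curve class, assuming the known deep theorems (Gross–Zagier, Kolyvagin,
Kato, Skinner–Urban) as cited black boxes (conditional/label B). No claim of proving BSD outright;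
every result is labelled (A) Mathlib-unconditional, (B) conditional on cited literature theorems
stated as hypotheses, or (C) speculative." This file is label **(A)**: Mathlib/tree theorems only,
no named fact, no `sorry`. Nothing booked; class X11b stays CONSTRUCTION-SHAPED.

## What this file proves (small pieces of the exact count, route R1's atom (P6) `BaseSelmerCountAt`)

* `relIndex_eq_of_squeeze_above` / `relIndex_eq_of_squeeze_below` — if `A₁ ≤ X ≤ A₂ ≤ L` and
  `[L : A₁] = [L : A₂] = N ≠ 0` then `[L : X] = N`; if `T ≤ M₁ ≤ X ≤ M₂` and
  `[M₁ : T] = [M₂ : T] = N ≠ 0` then `[X : T] = N` (multiplicativity of the relative index).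
* `noInvariants_of_forall_torsion_eq_zero` — **`E(K)[p] = 0 ⟹ E(K̄)[p^∞]^{Γ_K} = 0`** (Galois
  descent `E(K̄)^{Γ_K} = E(K)` and `p`-divisibility); the global form of the injectivity hypothesis
  `hΓ` of `AcSelmer.natCard_selmerAcBase_eq_natCard_level` (gens 15–18 only had the LOCAL form,
  which is Castella's (iv)).
* `natCard_selmerGroup_eq_index_mul` — **`#Sel⁽ⁿ⁾(E/K) = [E(K) : nE(K)] · #(Ш(E/K) ∩ H¹(K,E)[n])`**
  (the Kummer sequence `0 → E(K)/n → Sel⁽ⁿ⁾ → Ш[n] → 0`, EXACT count; gens 15–18 used `≤`).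
* `pow_nsmul_eq_zero_of_mem_sha_inf_torsionBy`, `sha_inf_torsionBy_le_torsionBy`,
  `natCard_sha_inf_torsionBy_eq` — with `#Ш[p^∞] = p^v`: `p^v` kills `Ш ∩ H¹[p^k]`, and for
  `k ≥ v`, `#(Ш ∩ H¹[p^k]) = #Ш[p^∞]` EXACTLY.

References: [SilvermanAEC2009] VIII.§2, X.4.2; [MilneADT2006] I §6.
-/

noncomputable section

open scoped Classical

namespace Summit.BirchSwinnertonDyer.Rank1Residual.X11b.SelmerCount

open WeierstrassCurve Literature.NumberTheory.EllipticCurves Literature.NumberTheory.GaloisRepresentations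
open Summit.BirchSwinnertonDyer.Rank1Residual.X11b.LocBridge
open IsDedekindDomain NumberField

universe u

/-! ## §1. Two squeezes for the relative index -/

section Squeeze

variable {G : Type*} [AddCommGroup G]

/-- **Squeeze from above**: `A₁ ≤ X ≤ A₂ ≤ L`, `[L : A₁] = [L : A₂] = N ≠ 0` `⟹` `[L : X] = N`
(`[L : A₁] = [X : A₁][L : X]`, `[L : X] = [A₂ : X][L : A₂]`). [folklore] -/
theorem relIndex_eq_of_squeeze_above {A₁ X A₂ L : AddSubgroup G} (h₁ : A₁ ≤ X) (h₂ : X ≤ A₂)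
    (h₃ : A₂ ≤ L) {N : ℕ} (hN : N ≠ 0) (hA₁ : A₁.relIndex L = N) (hA₂ : A₂.relIndex L = N) :
    X.relIndex L = N := by
  have e1 := AddSubgroup.relIndex_mul_relIndex A₁ X L h₁ (h₂.trans h₃)
  have e2 := AddSubgroup.relIndex_mul_relIndex X A₂ L h₂ h₃
  rw [hA₁] at e1
  rw [hA₂] at e2
  have h : A₁.relIndex X * X.relIndex A₂ * N = 1 * N := by
    rw [mul_assoc, e2, e1, one_mul]
  have h1 : A₁.relIndex X * X.relIndex A₂ = 1 :=
    Nat.eq_of_mul_eq_mul_right (Nat.pos_of_ne_zero hN) h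
  rw [← e2, Nat.eq_one_of_mul_eq_one_left h1, one_mul]

/-- **Squeeze from below**: `T ≤ M₁ ≤ X ≤ M₂`, `[M₁ : T] = [M₂ : T] = N ≠ 0` `⟹` `[X : T] = N`.
[folklore] -/
theorem relIndex_eq_of_squeeze_below {T M₁ X M₂ : AddSubgroup G} (h₀ : T ≤ M₁) (h₁ : M₁ ≤ X)
    (h₂ : X ≤ M₂) {N : ℕ} (hN : N ≠ 0) (hM₁ : T.relIndex M₁ = N) (hM₂ : T.relIndex M₂ = N) :
    T.relIndex X = N := by
  have e1 := AddSubgroup.relIndex_mul_relIndex T M₁ X h₀ h₁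
  have e2 := AddSubgroup.relIndex_mul_relIndex T X M₂ (h₀.trans h₁) h₂
  rw [hM₁] at e1
  rw [hM₂, ← e1] at e2
  have h : M₁.relIndex X * X.relIndex M₂ * N = 1 * N := by
    calc M₁.relIndex X * X.relIndex M₂ * N = N * M₁.relIndex X * X.relIndex M₂ := by ring
      _ = N := e2
      _ = 1 * N := (one_mul N).symm
  have h1 : M₁.relIndex X * X.relIndex M₂ = 1 :=
    Nat.eq_of_mul_eq_mul_right (Nat.pos_of_ne_zero hN) h
  rw [← e1, Nat.eq_one_of_mul_eq_one_right h1, mul_one]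

/-- For `H ≤ K`: `#H · [K : H] = #K`. [folklore] -/
theorem card_mul_relIndex_of_le {H K : AddSubgroup G} (h : H ≤ K) :
    Nat.card H * H.relIndex K = Nat.card K := by
  rw [AddSubgroup.relIndex, ← Nat.card_congr (AddSubgroup.addSubgroupOfEquivOfLe h).toEquiv]
  exact AddSubgroup.card_mul_index _

/-- In a subgroup of index `N` in `K`, `N • y ∈ H` for `y ∈ K`; hence `c • y ∈ X` whenever
`[K : H] = c` and `H ≤ X`. [folklore] -/
theorem nsmul_mem_of_relIndex_eq {H K X : AddSubgroup G} (hHX : H ≤ X) {c : ℕ} (hc : H.relIndex K = c)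
    {y : G} (hy : y ∈ K) : c • y ∈ X := by
  rw [← hc]
  exact hHX (AddSubgroup.nsmul_relIndex_mem H hy)

end Squeeze

/-! ## §2. `E(K)[p] = 0 ⟹ E(K̄)[p^∞]^{Γ_K} = 0` -/

section NoInvariants

variable {K : Type u} [Field K] [NumberField K] (W : WeierstrassCurve K) (p : ℕ)

/-- **No rational `p`-torsion `⟹` no `Γ_K`-invariant `p`-primary geometric torsion**: a `Γ_K`-fixed
point of `E(K̄)[p^∞]` is rational (Galois descent, `mem_range_toGeomPoints_iff`) and killed by a
power of `p`, hence zero when `E(K)[p] = 0`. This is the injectivity input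
(`H⁰(K, E[p^∞]) = 0`) of `H¹(K, E[p^k]) ↪ H¹(K, E[p^∞])`. [cite: SilvermanAEC2009, VIII.§1–§2]
[cite: GreenbergLNM1716, §2 (p. 74)] -/
theorem noInvariants_of_forall_torsion_eq_zero (hE : ∀ P : W.toAffine.Point, p • P = 0 → P = 0)
    (Q : W.geomPrimaryTorsion p) (hQ : ∀ σ : Field.absoluteGaloisGroup K, primaryGaloisModule W p σ Q = Q) :
    Q = 0 := by
  haveI : PerfectField K := PerfectField.ofCharZero
  obtain ⟨j, hj⟩ := (AddCommGroup.mem_primaryComponent).mp Q.2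
  have hfix : (Q : geomPoints W) ∈ MulAction.fixedPoints (Field.absoluteGaloisGroup K) (geomPoints W) := by
    intro σ
    have h := congrArg (fun R : W.geomPrimaryTorsion p => (R : geomPoints W)) (hQ σ)
    simpa only [primaryGaloisModule, ofSMul_apply_apply, primaryComponent.coe_smul] using h
  obtain ⟨R, hR⟩ := (mem_range_toGeomPoints_iff W _).mpr hfix
  have hR0 : p ^ j • R = 0 := by
    apply toGeomPoints_injective W
    rw [map_nsmul, hR, map_zero, hj]
  have hR' : R = 0 := KummerDecomp.eq_zero_of_pow_nsmul_eq_zero p hE j hR0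
  apply Subtype.ext
  rw [ZeroMemClass.coe_zero, ← hR, hR', map_zero]

end NoInvariants

/-! ## §3. `#Sel⁽ⁿ⁾ = [E(K) : nE(K)] · #(Ш ∩ H¹(K, E)[n])` -/

section SelmerCard

variable {K : Type u} [Field K] [NumberField K] (W : WeierstrassCurve K) [W.IsElliptic] {n : ℤ}
  (hn : n ≠ 0)

include hn in
/-- **The exact Selmer count from the Kummer sequence** `0 → E(K)/nE(K) → Sel⁽ⁿ⁾(E/K) → Ш(E/K)[n] → 0`
(`Ш[n]` realised as `Ш ∩ H¹(K, E)[n]`, tree `map_torsionH1ToH1_selmerGroup_holds`; exactness in the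
middle `mem_range_kummerMapTorsion_of_torsionH1ToH1_eq_zero`; `ker κ_n = nE(K)`,
`kummerMapTorsion_ker`): `#Sel⁽ⁿ⁾ = [E(K) : nE(K)] · #(Ш ∩ H¹(K,E)[n])`.
[cite: SilvermanAEC2009, Thm. X.4.2] -/
theorem natCard_selmerGroup_eq_index_mul :
    Nat.card (selmerGroup W n) =
      ((zsmulAddGroupHom n : W.toAffine.Point →+ _).range).index *
        Nat.card ↥(W.sha ⊓ AddSubgroup.torsionBy W.galH1 n) := by
  haveI : PerfectField K := PerfectField.ofCharZero
  have hdiv := W.zsmul_geomPoints_surjective_holds hn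
  set κ := kummerMapTorsion W n hdiv with hκ
  set g : selmerGroup W n →+ W.galH1 := (torsionH1ToH1 W n).comp (selmerGroup W n).subtype with hg
  have hrange : g.range = W.sha ⊓ AddSubgroup.torsionBy W.galH1 n := by
    rw [hg, AddMonoidHom.range_comp, AddSubgroup.range_subtype]
    exact W.map_torsionH1ToH1_selmerGroup_holds hn
  have hκSel : κ.range ≤ selmerGroup W n := by
    rintro _ ⟨P, rfl⟩
    exact StrictAtPlace.kummerMapTorsion_mem_selmerGroup W hdiv P
  have hker : g.ker = κ.range.addSubgroupOf (selmerGroup W n) := by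
    ext ⟨x, hx⟩
    rw [AddMonoidHom.mem_ker, AddSubgroup.mem_addSubgroupOf]
    change torsionH1ToH1 W n x = 0 ↔ x ∈ κ.range
    constructor
    · exact mem_range_kummerMapTorsion_of_torsionH1ToH1_eq_zero W n hdiv x
    · rintro ⟨P, rfl⟩
      exact torsionH1ToH1_kummerMapTorsion W n hdiv P
  have hcardker : Nat.card g.ker = Nat.card κ.range := by
    rw [hker]
    exact Nat.card_congr (AddSubgroup.addSubgroupOfEquivOfLe hκSel).toEquiv
  have hcardκ : Nat.card κ.range = ((zsmulAddGroupHom n : W.toAffine.Point →+ _).range).index := by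
    rw [← AddSubgroup.index_ker κ, hκ, kummerMapTorsion_ker]
  rw [← AddSubgroup.card_mul_index g.ker, AddSubgroup.index_ker g, hrange, hcardker, hcardκ]

end SelmerCard

/-! ## §4. `Ш ∩ H¹(K, E)[p^k]` versus `Ш[p^∞]` -/

section Sha

variable {K : Type u} [Field K] [NumberField K] (E : WeierstrassCurve K) (p : ℕ)

/-- With `#Ш[p^∞] = p^v`: `p^v` kills every class of `Ш ∩ H¹(K, E)[p^k]` (such a class lies in the
finite group `Ш[p^∞]`, of order `p^v`). [folklore] -/
theorem pow_nsmul_eq_zero_of_mem_sha_inf_torsionBy [Finite E.sha] {v : ℕ}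
    (hv : Nat.card (AddCommGroup.primaryComponent E.sha p) = p ^ v) (k : ℕ) {z : E.galH1}
    (hz : z ∈ E.sha ⊓ AddSubgroup.torsionBy E.galH1 ((p ^ k : ℕ) : ℤ)) : p ^ v • z = 0 := by
  have hzk : (p ^ k) • z = 0 := AddSubgroup.torsionBy.nsmul_iff.mp hz.2
  set z' : AddCommGroup.primaryComponent E.sha p :=
    ⟨⟨z, hz.1⟩, (AddCommGroup.mem_primaryComponent).mpr ⟨k, Subtype.ext (by simpa using hzk)⟩⟩
    with hz'
  have h := card_nsmul_eq_zero' (x := z')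
  rw [hv] at h
  have h2 := congrArg (fun t : AddCommGroup.primaryComponent E.sha p => ((t : E.sha) : E.galH1)) h
  simpa using h2

/-- With `#Ш[p^∞] = p^v`: `Ш ∩ H¹(K, E)[p^k] ≤ H¹(K, E)[p^v]`. [folklore] -/
theorem sha_inf_torsionBy_le_torsionBy [Finite E.sha] {v : ℕ}
    (hv : Nat.card (AddCommGroup.primaryComponent E.sha p) = p ^ v) (k : ℕ) :
    E.sha ⊓ AddSubgroup.torsionBy E.galH1 ((p ^ k : ℕ) : ℤ) ≤
      AddSubgroup.torsionBy E.galH1 ((p ^ v : ℕ) : ℤ) :=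
  fun _ hz => AddSubgroup.torsionBy.nsmul_iff.mpr
    (pow_nsmul_eq_zero_of_mem_sha_inf_torsionBy E p hv k hz)

/-- With `#Ш[p^∞] = p^v` and `k ≥ v`: **`#(Ш ∩ H¹(K, E)[p^k]) = #Ш[p^∞]`** (`Ш[p^∞]` is killed by
`p^v ∣ p^k`, so `Ш[p^∞] = Ш[p^k]`). [folklore] -/
theorem natCard_sha_inf_torsionBy_eq [Finite E.sha] {v : ℕ}
    (hv : Nat.card (AddCommGroup.primaryComponent E.sha p) = p ^ v) {k : ℕ} (hk : v ≤ k) :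
    Nat.card ↥(E.sha ⊓ AddSubgroup.torsionBy E.galH1 ((p ^ k : ℕ) : ℤ)) =
      Nat.card (AddCommGroup.primaryComponent E.sha p) := by
  refine le_antisymm (natCard_sha_inf_torsionBy_le E p k) ?_
  haveI : Finite ↥(E.sha ⊓ AddSubgroup.torsionBy E.galH1 ((p ^ k : ℕ) : ℤ)) :=
    Finite.of_injective _ (AddSubgroup.inclusion_injective inf_le_left)
  refine Nat.card_le_card_of_injective
    (fun z => (⟨((z : AddCommGroup.primaryComponent E.sha p) : E.sha),
      ⟨((z : AddCommGroup.primaryComponent E.sha p) : E.sha).2, ?_⟩⟩ :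
        ↥(E.sha ⊓ AddSubgroup.torsionBy E.galH1 ((p ^ k : ℕ) : ℤ)))) ?_
  · apply AddSubgroup.torsionBy.nsmul_iff.mpr
    have h := card_nsmul_eq_zero' (x := z)
    rw [hv] at h
    have h2 : p ^ v • ((((z : AddCommGroup.primaryComponent E.sha p) : E.sha)) : E.galH1) = 0 := by
      have := congrArg (fun t : AddCommGroup.primaryComponent E.sha p => ((t : E.sha) : E.galH1)) h
      simpa using this
    rw [← Nat.sub_add_cancel hk, pow_add, mul_nsmul', h2, nsmul_zero]
  · intro x y hxy
    have h := congrArg Subtype.val hxy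
    exact Subtype.ext (Subtype.ext h)

end Sha

/-! ## §5. The same with only `Ш[p^∞]` finite (the hypothesis Gross–Zagier–Kolyvagin descent
supplies over a quadratic field, `mordellWeilRank_baseChange_eq_one_and_finite_sha`) -/

section ShaPrimary

variable {K : Type u} [Field K] [NumberField K] (E : WeierstrassCurve K) (p : ℕ)

/-- `#A[p^∞] = p^v` for some `v` as soon as `A[p^∞]` is finite (a finite `p`-primary group).
[folklore] -/
theorem exists_natCard_primaryComponent_eq_pow_of_finite {G : Type*} [AddCommGroup G] [Fact p.Prime]
    [Finite (AddCommGroup.primaryComponent G p)] :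
    ∃ v : ℕ, Nat.card (AddCommGroup.primaryComponent G p) = p ^ v := by
  have hPG : IsPGroup p (Multiplicative (AddCommGroup.primaryComponent G p)) := fun g => by
    obtain ⟨m, hm⟩ := (AddCommGroup.mem_primaryComponent).mp (Multiplicative.toAdd g).2
    refine ⟨m, ?_⟩
    apply Multiplicative.toAdd.injective
    rw [toAdd_pow, toAdd_one]
    exact Subtype.ext (by rw [AddSubmonoidClass.coe_nsmul, hm]; rfl)
  obtain ⟨v, hv⟩ := IsPGroup.iff_card.mp hPG
  exact ⟨v, hv⟩

/-- `Ш ∩ H¹(K,E)[p^k]` embeds in `Ш[p^∞]`; in particular it is finite when `Ш[p^∞]` is, and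
`#(Ш ∩ H¹[p^k]) ≤ #Ш[p^∞]` (gen 16's `natCard_sha_inf_torsionBy_le` asked for all of `Ш` finite).
[folklore] -/
theorem natCard_sha_inf_torsionBy_le_of_finite [Finite (AddCommGroup.primaryComponent E.sha p)]
    (k : ℕ) :
    Finite ↥(E.sha ⊓ AddSubgroup.torsionBy E.galH1 ((p ^ k : ℕ) : ℤ)) ∧
      Nat.card ↥(E.sha ⊓ AddSubgroup.torsionBy E.galH1 ((p ^ k : ℕ) : ℤ)) ≤
        Nat.card (AddCommGroup.primaryComponent E.sha p) := by
  set ι : ↥(E.sha ⊓ AddSubgroup.torsionBy E.galH1 ((p ^ k : ℕ) : ℤ)) →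
      AddCommGroup.primaryComponent E.sha p :=
    fun x => ⟨⟨x.1, x.2.1⟩, (AddCommGroup.mem_primaryComponent).mpr ⟨k, Subtype.ext (by
      have hx : (p ^ k) • (x : E.galH1) = 0 := AddSubgroup.torsionBy.nsmul_iff.mp x.2.2
      simpa using hx)⟩⟩ with hι
  have hinj : Function.Injective ι := by
    intro x y hxy
    apply Subtype.ext
    have := congrArg (fun z : AddCommGroup.primaryComponent E.sha p => ((z : E.sha) : E.galH1)) hxy
    exact this
  exact ⟨Finite.of_injective ι hinj, Nat.card_le_card_of_injective ι hinj⟩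

/-- With `#Ш[p^∞] = p^v` (only `Ш[p^∞]` finite): `p^v` kills `Ш ∩ H¹(K, E)[p^k]`. [folklore] -/
theorem pow_nsmul_eq_zero_of_mem_sha_inf_torsionBy' [Finite (AddCommGroup.primaryComponent E.sha p)]
    {v : ℕ} (hv : Nat.card (AddCommGroup.primaryComponent E.sha p) = p ^ v) (k : ℕ) {z : E.galH1}
    (hz : z ∈ E.sha ⊓ AddSubgroup.torsionBy E.galH1 ((p ^ k : ℕ) : ℤ)) : p ^ v • z = 0 := by
  have hzk : (p ^ k) • z = 0 := AddSubgroup.torsionBy.nsmul_iff.mp hz.2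
  set z' : AddCommGroup.primaryComponent E.sha p :=
    ⟨⟨z, hz.1⟩, (AddCommGroup.mem_primaryComponent).mpr ⟨k, Subtype.ext (by simpa using hzk)⟩⟩
    with hz'
  have h := card_nsmul_eq_zero' (x := z')
  rw [hv] at h
  have h2 := congrArg (fun t : AddCommGroup.primaryComponent E.sha p => ((t : E.sha) : E.galH1)) h
  simpa using h2

/-- With `#Ш[p^∞] = p^v` (only `Ш[p^∞]` finite) and `k ≥ v`: `#(Ш ∩ H¹(K, E)[p^k]) = #Ш[p^∞]`.
[folklore] -/
theorem natCard_sha_inf_torsionBy_eq' [Finite (AddCommGroup.primaryComponent E.sha p)] {v : ℕ}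
    (hv : Nat.card (AddCommGroup.primaryComponent E.sha p) = p ^ v) {k : ℕ} (hk : v ≤ k) :
    Nat.card ↥(E.sha ⊓ AddSubgroup.torsionBy E.galH1 ((p ^ k : ℕ) : ℤ)) =
      Nat.card (AddCommGroup.primaryComponent E.sha p) := by
  obtain ⟨hfin, hle⟩ := natCard_sha_inf_torsionBy_le_of_finite E p k
  refine le_antisymm hle ?_
  refine Nat.card_le_card_of_injective
    (fun z => (⟨((z : AddCommGroup.primaryComponent E.sha p) : E.sha),
      ⟨((z : AddCommGroup.primaryComponent E.sha p) : E.sha).2, ?_⟩⟩ :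
        ↥(E.sha ⊓ AddSubgroup.torsionBy E.galH1 ((p ^ k : ℕ) : ℤ)))) ?_
  · apply AddSubgroup.torsionBy.nsmul_iff.mpr
    have h := card_nsmul_eq_zero' (x := z)
    rw [hv] at h
    have h2 : p ^ v • ((((z : AddCommGroup.primaryComponent E.sha p) : E.sha)) : E.galH1) = 0 := by
      have := congrArg (fun t : AddCommGroup.primaryComponent E.sha p => ((t : E.sha) : E.galH1)) h
      simpa using this
    rw [← Nat.sub_add_cancel hk, pow_add, mul_nsmul', h2, nsmul_zero]
  · intro x y hxy
    have h := congrArg Subtype.val hxy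
    exact Subtype.ext (Subtype.ext h)

end ShaPrimary

end Summit.BirchSwinnertonDyer.Rank1Residual.X11b.SelmerCount

end
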